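import Mathlib
import HarnessLib
import Summits.HubbardSuperconductivity.HubbardSuperconductivity.Theorems.KLProgrammeKLRegimeTwoPointLimitTwoShellBound
import Summits.HubbardSuperconductivity.HubbardSuperconductivity.Theorems.KLProgrammeKLRegimeEngineV8DefsG11

/-!
# Route `KLProgramme` — ENGINE child (stmt-HubbardSuperconductivity-20437 `KLRegimeEngineV17F2`), rev-13 package `klEngGeo11`:
# the two-shell AREA predicate `TwoShellFrameAreaAt` (`…EngineV8DefsG11` §1) HOLDS AT THE BARE FRAME `K = 0` — the dictionary
# from p1b's `kltb_exists_twoShell_bound` (ℝ × ℝ, `eps2`, `∀ m₀ m₁ : ℤ`) to the engine's vocabulary (`Momentum`, `brillouinZone`,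
# `frameLevel μ 0`, `torusSupNorm`), on the whole shell range `0 < ε₁ ≤ ε₂ ≤ klE0`

Cell `gate-hubbard-kl`, seat hubbard-kl-k3c2-p2 g15 (author of `…DefsG11`; WITNESS-TARGETS-G11.md §2).  The deferred package `klTwoShellPack` of the
rev-13 token `klEngGeo11 := klEngGeo10.addTwoShell klTSA` asks for `∃ A u, TwoShellFrameAreaAt A u`: for EVERY admissible frame `K` (`FrameOK R U N μ K`)
`vol{k ∈ BZ : |e_K(k)| < ε₁, |e_K(k − w)| ≤ ε₂} ≤ A·ε₁·(ε₂/r + √ε₂)` (`0 < ε₁ ≤ ε₂ ≤ klE0`, `r ≤ |w|_𝕋`).  This file proves the conclusion AT `K = 0`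
(**`twoShell_volume_frameLevel_zero_le`**, `∃ A ≥ 0` uniform on `klWindowC`) — the satisfiability witness of the frozen text's SHAPE at the bare frame and
the dictionary the full witness will reuse:
* `klWindowC = [-1.05, -0.15] ⊂ [a + η⋆, b − η⋆]` with `(a, b, η⋆) = (-1.1, -0.1, 0.05)`; shells `ε₂ ≤ klE0 = 1/32` keep `μ ± ε₁ ∈ [a, b]`;
* small shells `ε₂ ≤ ε₀`: clause (iv) of `kltb_exists_twoShell_bound` (`C₁ε₁ε₂/r + C₂ε₁√ε₂`), the torus distance hypothesis from `torusAbs_le`;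
* large shells `ε₀ < ε₂ ≤ 1/32`: the tube reduction `klta_volume_twoShell_le` (`≤ 16Lε₁ × 2π`) and `2π·16L·ε₁ ≤ (32πL/√ε₀)·ε₁√ε₂`;
* transport `Momentum → ℝ × ℝ` by the measure-preserving coordinate map `finTwoArrow ∘ ofLp` (`frameLevel_zero`, `TrigPolyC4v.eval_zero`).
What is NOT here: the frame-uniform witness (`K ≠ 0`).  NOTE for it (located, this seat): `TwoShellFrameAreaAt` quantifies `∀ N`, so from `FrameOK` (ii)
only the `C⁰/C¹` sizes of `K` are `N`-uniform (`κ₂ ≤ Gfr₂·uPow 2 U·(N+1)` is not); second-order data must be read from `FrameOK` (i)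
`GeomConstants (frameLevel μ K) 7 (3/80) (1/2) (3/200)` (`klE0 = 1/32 < r₀ = 3/80`).
Everything is PROVED; no definitions, no named facts; nothing asserts any stub or superconductivity.
-/

noncomputable section

namespace Summit.HubbardSuperconductivity.HubbardSuperconductivity.Theorems.EngineV8

set_option linter.dupNamespace false -- summit = problem name (single-conjunct summit), D-0017

open Real Set MeasureTheory
open scoped ENNReal
open Literature.MathematicalPhysics.QuantumLattice Literature.MathematicalPhysics.QuantumLattice.BandSectorCounting
open Summit.HubbardSuperconductivity.HubbardSuperconductivity.Theorems.KLRegimeSplit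
open Summit.HubbardSuperconductivity.HubbardSuperconductivity.Theorems.KLProgrammeLegKernels
open Summit.HubbardSuperconductivity.HubbardSuperconductivity.Theorems.DispersionFlow

/-- The bare-frame band at a momentum: `e₀(k) − μ = −2(cos k₀ + cos k₁) − μ`. -/
theorem frameLevel_zero_apply (μ : ℝ) (k : Momentum) : frameLevel μ 0 k = -2 * (Real.cos (k 0) + Real.cos (k 1)) - μ := by
  simp only [frameLevel, squareDispersion, TrigPolyC4v.eval_zero]
  ring

/-- The same at a difference: `e₀(k − w) − μ = −2(cos(k₀ − w₀) + cos(k₁ − w₁)) − μ`. -/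
theorem frameLevel_zero_sub_apply (μ : ℝ) (k w : Momentum) :
    frameLevel μ 0 (k - w) = -2 * (Real.cos (k 0 - w 0) + Real.cos (k 1 - w 1)) - μ := by
  rw [frameLevel_zero_apply]
  rfl

/-- The engine's two-shell set at the bare frame is the preimage of p1b's planar two-shell set under the coordinate map `k ↦ (k 0, k 1)`. -/
theorem twoShell_frameLevel_zero_eq_preimage (μ ε₁ ε₂ : ℝ) (w : Momentum) :
    {k : Momentum | k ∈ brillouinZone ∧ |frameLevel μ 0 k| < ε₁ ∧ |frameLevel μ 0 (k - w)| ≤ ε₂} =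
      (fun k : Momentum => MeasurableEquiv.finTwoArrow (WithLp.ofLp k)) ⁻¹'
        {x : ℝ × ℝ | (x.1 ∈ Ico (-π) π ∧ x.2 ∈ Ico (-π) π) ∧
          |-2 * (Real.cos x.1 + Real.cos x.2) - μ| < ε₁ ∧
          |-2 * (Real.cos (x.1 - w 0) + Real.cos (x.2 - w 1)) - μ| ≤ ε₂} := by
  ext k
  simp only [mem_setOf_eq, mem_preimage, brillouinZone, frameLevel_zero_apply, MeasurableEquiv.finTwoArrow_apply, Fin.forall_fin_two,
    Fin.isValue]
  rfl

/-- The coordinate map `Momentum → ℝ × ℝ`, `k ↦ (k 0, k 1)`, preserves Lebesgue measure. [folklore] -/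
theorem measurePreserving_momentum_prod :
    MeasurePreserving (fun k : Momentum => MeasurableEquiv.finTwoArrow (WithLp.ofLp k)) volume volume :=
  (volume_preserving_finTwoArrow ℝ).comp (PiLp.volume_preserving_ofLp (Fin 2))

/-- **`TwoShellFrameAreaAt`'s conclusion at the bare frame `K = 0`**: there is `A ≥ 0` with
`vol{k ∈ BZ : |e₀(k) − μ| < ε₁, |e₀(k − w) − μ| ≤ ε₂} ≤ A·ε₁·(ε₂/r + √ε₂)` for every `μ ∈ klWindowC`, `0 < ε₁ ≤ ε₂ ≤ klE0`, every transfer `w` and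
every `0 < r ≤ |w|_𝕋` (DECOMP App. E Lemma E.1 / E.3 in the engine's currency; p1b's `kltb_exists_twoShell_bound` + the large-shell tube bound). -/
theorem twoShell_volume_frameLevel_zero_le :
    ∃ A : ℝ, 0 ≤ A ∧ ∀ μ ∈ klWindowC, ∀ (ε₁ ε₂ : ℝ), 0 < ε₁ → ε₁ ≤ ε₂ → ε₂ ≤ klE0 →
      ∀ (w : Momentum) (r : ℝ), 0 < r → r ≤ torusSupNorm (w 0, w 1) →
        volume {k : Momentum | k ∈ brillouinZone ∧ |frameLevel μ 0 k| < ε₁ ∧ |frameLevel μ 0 (k - w)| ≤ ε₂} ≤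
          ENNReal.ofReal (A * ε₁ * (ε₂ / r + Real.sqrt ε₂)) := by
  have hπ := Real.pi_pos
  have ha : (-4 : ℝ) < -1.1 := by norm_num
  have hab : (-1.1 : ℝ) ≤ -0.1 := by norm_num
  have hb : (-0.1 : ℝ) < 0 := by norm_num
  have hηs : (0 : ℝ) < 0.05 := by norm_num
  obtain ⟨ε₀, v, C₁, C₂, hε₀, -, hC₁, hC₂, hmain⟩ := kltb_exists_twoShell_bound ha hab hb hηs
  obtain ⟨L, hL0, hL⟩ := klta_volume_twoShell_le ha hb
  set A : ℝ := C₁ + C₂ + 32 * π * L / Real.sqrt ε₀ with hA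
  have hsε₀ : 0 < Real.sqrt ε₀ := Real.sqrt_pos.2 hε₀
  have hA0 : 0 ≤ A := by rw [hA]; positivity
  refine ⟨A, hA0, fun μ hμ ε₁ ε₂ hε₁ h12 h2 w r hr hrw => ?_⟩
  have hμ1 : (-1.05 : ℝ) ≤ μ := hμ.1
  have hμ2 : μ ≤ (-0.15 : ℝ) := hμ.2
  have hE0 : klE0 = 1 / 32 := rfl
  have hε₂ : 0 < ε₂ := hε₁.trans_le h12
  have hε₁E : ε₁ ≤ 1 / 32 := by rw [← hE0]; exact h12.trans h2
  -- transport to `ℝ × ℝ`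
  rw [twoShell_frameLevel_zero_eq_preimage,
    measurePreserving_momentum_prod.measure_preimage (klta_measurableSet_twoShell μ ε₁ ε₂ (w 0) (w 1)).nullMeasurableSet]
  -- the torus distance of the transfer
  have hrw' : ∀ m₀ m₁ : ℤ, r ≤ max |w 0 - m₀ * (2 * π)| |w 1 - m₁ * (2 * π)| := by
    intro m₀ m₁
    refine hrw.trans ?_
    unfold torusSupNorm
    exact max_le_max (torusAbs_le _ _) (torusAbs_le _ _)
  have hsum0 : 0 ≤ ε₂ / r + Real.sqrt ε₂ := by positivity
  rcases le_or_gt ε₂ ε₀ with hsmall | hlarge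
  · -- small shells: clause (iv) of p1b's theorem
    have h := (hmain μ ε₁ ε₂ (w 0) (w 1) (by linarith) (by linarith) hε₁ h12 hsmall).2.2.2 r hr hrw'
    refine h.trans (ENNReal.ofReal_le_ofReal ?_)
    have h1 : C₁ * ε₁ * ε₂ / r + C₂ * ε₁ * Real.sqrt ε₂ ≤ (C₁ + C₂) * ε₁ * (ε₂ / r + Real.sqrt ε₂) := by
      have e : (C₁ + C₂) * ε₁ * (ε₂ / r + Real.sqrt ε₂) =
          (C₁ * ε₁ * ε₂ / r + C₂ * ε₁ * Real.sqrt ε₂) + (C₁ * ε₁ * Real.sqrt ε₂ + C₂ * ε₁ * (ε₂ / r)) := by ring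
      rw [e]
      have : 0 ≤ C₁ * ε₁ * Real.sqrt ε₂ + C₂ * ε₁ * (ε₂ / r) := by positivity
      linarith
    have h2 : (C₁ + C₂) * ε₁ * (ε₂ / r + Real.sqrt ε₂) ≤ A * ε₁ * (ε₂ / r + Real.sqrt ε₂) := by
      have h32 : 0 ≤ 32 * π * L / Real.sqrt ε₀ := by positivity
      have hle : C₁ + C₂ ≤ A := by rw [hA]; linarith
      exact mul_le_mul_of_nonneg_right (mul_le_mul_of_nonneg_right hle hε₁.le) hsum0
    exact h1.trans h2
  · -- large shells: the tube reduction and the trivial angular bound `2π`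
    have hμm : μ - ε₁ ∈ Icc (-1.1 : ℝ) (-0.1) := ⟨by linarith, by linarith⟩
    have hμp : μ + ε₁ ∈ Icc (-1.1 : ℝ) (-0.1) := ⟨by linarith, by linarith⟩
    have h := hL μ ε₁ ε₂ (w 0) (w 1) hε₁ hμm hμp
    have hang : volume {θ ∈ Ioo (-π) π | |eps2 (bandX μ θ - w 0) (bandY μ θ - w 1) - μ| ≤ ε₂ + 4 * L * ε₁} ≤
        ENNReal.ofReal (2 * π) := by
      calc _ ≤ volume (Ioo (-π) π) := measure_mono (fun θ hθ => hθ.1)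
        _ = ENNReal.ofReal (2 * π) := by rw [Real.volume_Ioo]; ring_nf
    refine h.trans ?_
    calc ENNReal.ofReal (16 * L * ε₁) *
          volume {θ ∈ Ioo (-π) π | |eps2 (bandX μ θ - w 0) (bandY μ θ - w 1) - μ| ≤ ε₂ + 4 * L * ε₁}
        ≤ ENNReal.ofReal (16 * L * ε₁) * ENNReal.ofReal (2 * π) := by gcongr
      _ = ENNReal.ofReal (16 * L * ε₁ * (2 * π)) := (ENNReal.ofReal_mul (by positivity)).symm
      _ ≤ ENNReal.ofReal (A * ε₁ * (ε₂ / r + Real.sqrt ε₂)) := ENNReal.ofReal_le_ofReal ?_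
    -- `32πL ε₁ ≤ (32πL/√ε₀)·ε₁·√ε₂ ≤ A ε₁ (ε₂/r + √ε₂)`
    have hsq : Real.sqrt ε₀ ≤ Real.sqrt ε₂ := Real.sqrt_le_sqrt hlarge.le
    have h1 : 16 * L * ε₁ * (2 * π) ≤ 32 * π * L / Real.sqrt ε₀ * ε₁ * Real.sqrt ε₂ := by
      have e : 32 * π * L / Real.sqrt ε₀ * ε₁ * Real.sqrt ε₂ = 16 * L * ε₁ * (2 * π) * (Real.sqrt ε₂ / Real.sqrt ε₀) := by
        field_simp
        ring
      rw [e]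
      have hq : 1 ≤ Real.sqrt ε₂ / Real.sqrt ε₀ := by rw [le_div_iff₀ hsε₀, one_mul]; exact hsq
      have h0 : 0 ≤ 16 * L * ε₁ * (2 * π) := by positivity
      nlinarith
    have h2 : 32 * π * L / Real.sqrt ε₀ * ε₁ * Real.sqrt ε₂ ≤ A * ε₁ * (ε₂ / r + Real.sqrt ε₂) := by
      have hle : 32 * π * L / Real.sqrt ε₀ ≤ A := by rw [hA]; linarith
      have hq0 : 0 ≤ ε₂ / r := by positivity
      have hs : Real.sqrt ε₂ ≤ ε₂ / r + Real.sqrt ε₂ := by linarith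
      calc 32 * π * L / Real.sqrt ε₀ * ε₁ * Real.sqrt ε₂ ≤ A * ε₁ * Real.sqrt ε₂ :=
            mul_le_mul_of_nonneg_right (mul_le_mul_of_nonneg_right hle hε₁.le) (Real.sqrt_nonneg _)
        _ ≤ A * ε₁ * (ε₂ / r + Real.sqrt ε₂) := mul_le_mul_of_nonneg_left hs (by positivity)
    exact h1.trans h2

/-- **The frozen predicate's body at `K = 0`**: for every `R`, `U`, `N` the `TwoShellFrameAreaAt` inequality holds at the bare frame with the constant of
`twoShell_volume_frameLevel_zero_le` (the `FrameOK` hypothesis is not needed there). -/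
theorem twoShellFrameArea_zero_frame :
    ∃ A : ℝ, 0 ≤ A ∧ ∀ (R : RenConsts) (U : ℝ), ∀ μ ∈ klWindowC, ∀ (N : ℕ), FrameOK R U N μ 0 →
      ∀ (ε₁ ε₂ : ℝ), 0 < ε₁ → ε₁ ≤ ε₂ → ε₂ ≤ klE0 → ∀ (w : Momentum) (r : ℝ), 0 < r → r ≤ torusSupNorm (w 0, w 1) →
        volume {k : Momentum | k ∈ brillouinZone ∧ |frameLevel μ 0 k| < ε₁ ∧ |frameLevel μ 0 (k - w)| ≤ ε₂} ≤
          ENNReal.ofReal (A * ε₁ * (ε₂ / r + Real.sqrt ε₂)) := by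
  obtain ⟨A, hA, h⟩ := twoShell_volume_frameLevel_zero_le
  exact ⟨A, hA, fun _ _ μ hμ _ _ => h μ hμ⟩

end Summit.HubbardSuperconductivity.HubbardSuperconductivity.Theorems.EngineV8

end
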